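import Literature.AlgebraicGeometry.Motives.MixedHodgeStructureAbelianUniversal
import Literature.AlgebraicGeometry.Motives.MixedHodgeStructureHodgeNumbersAdditive
import Literature.AlgebraicGeometry.Motives.MixedHodgeStructureSubobjects
import HarnessLib

/-!
# Hodge numbers along exact sequences of mixed Hodge structures

Cattani–El Zein–Griffiths–Lê, *Hodge Theory*, Cor. 3.2.21 (ii) (= Deligne, *Théorie de Hodge II*,
Thm. 2.3.5 (iii)–(iv)): the functors `Gr^W_k` and `Gr_F^p Gr^W_k` on the abelian category of mixed
Hodge structures are exact. Numerically: along an exact sequence `H₁ → H₂ → H₃` of MHS (exact at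
`H₂`), `h^{p,q}(H₂) = h^{p,q}(Im f) + h^{p,q}(Im g)`, and for a short exact sequence
`0 → H₁ → H₂ → H₃ → 0`, `h^{p,q}(H₂) = h^{p,q}(H₁) + h^{p,q}(H₃)`. These are assembled here from the
rank–nullity identities `h(H) = h(Ker) + h(Im) = h(Im) + h(Coker)` of
`MixedHodgeStructureHodgeNumbersAdditive.lean` and `Ker g = Im f` as sub-MHS
(`MixedHodgeStructureSubobjects.lean`: a sub-MHS is determined by its subspace).

## Main results (all proved; no named facts)

* `Hom.ker_eq_range_of_exact` — `Ker g = Im f` as sub-MHS of `H₂`.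
* `Hom.hodgeNumber_eq_of_exact` — **`h^{p,q}(H₂) = h^{p,q}(Im f) + h^{p,q}(Im g)`**;
  `Hom.hodgeNumber_le_of_exact` — `h^{p,q}(H₂) ≤ h^{p,q}(H₁) + h^{p,q}(H₃)`;
  `Hom.hodgeNumber_eq_zero_of_exact`.
* `Hom.hodgeNumber_range_eq_of_injective` (`h(Im f) = h(H₁)`), `Hom.hodgeNumber_range_eq_of_surjective`
  (`h(Im g) = h(H₃)`), and **`Hom.hodgeNumber_eq_add_of_shortExact`** —
  `h^{p,q}(H₂) = h^{p,q}(H₁) + h^{p,q}(H₃)` for `0 → H₁ → H₂ → H₃ → 0`.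

## References

* [CattaniElZeinGriffithsLe2014] E. Cattani et al. (eds.), *Hodge Theory* (2014), Cor. 3.2.21 (ii).
* [DeligneHodgeII1971] P. Deligne, *Théorie de Hodge II*, Thm. 2.3.5 (iii)–(iv).
-/

noncomputable section

open scoped TensorProduct

namespace Literature.AlgebraicGeometry.Motives

namespace MixedHodgeStructure

universe u v w

variable {V : Type u} [AddCommGroup V] [Module ℚ V]
variable {V' : Type v} [AddCommGroup V'] [Module ℚ V']
variable {V'' : Type w} [AddCommGroup V''] [Module ℚ V'']
variable {H₁ : MixedHodgeStructure V} {H₂ : MixedHodgeStructure V'} {H₃ : MixedHodgeStructure V''}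

namespace Hom

/-- **`Ker g = Im f` as sub-MHS** along an exact sequence `H₁ → H₂ → H₃` (a sub-MHS is determined
by its subspace). [cite: CattaniElZeinGriffithsLe2014, Lemma 3.2.20] -/
theorem ker_eq_range_of_exact {f : MixedHodgeStructure.Hom H₁ H₂} {g : MixedHodgeStructure.Hom H₂ H₃}
    (hfg : Function.Exact f.toLinearMap g.toLinearMap) : g.ker = f.range :=
  SubMixedHodgeStructure.ext (by rw [ker_toSubmodule, range_toSubmodule, hfg.linearMap_ker_eq])

/-- **`h^{p,q}(H₂) = h^{p,q}(Im f) + h^{p,q}(Im g)` along an exact sequence `H₁ → H₂ → H₃` of MHS**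
(`h(H₂) = h(Ker g) + h(Im g)` and `Ker g = Im f`; Cor. 3.2.21 (ii)). [cite: CattaniElZeinGriffithsLe2014, Cor. 3.2.21 (ii)] -/
theorem hodgeNumber_eq_of_exact [FiniteDimensional ℚ V'] [FiniteDimensional ℚ V'']
    {f : MixedHodgeStructure.Hom H₁ H₂} {g : MixedHodgeStructure.Hom H₂ H₃}
    (hfg : Function.Exact f.toLinearMap g.toLinearMap) (p q : ℤ) :
    H₂.hodgeNumber p q =
      f.range.toMixedHodgeStructure.hodgeNumber p q + g.range.toMixedHodgeStructure.hodgeNumber p q := by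
  rw [g.hodgeNumber_source_eq, ker_eq_range_of_exact hfg]

/-- **`h^{p,q}(Im f) = h^{p,q}(H₁)` for an injective morphism** (`H₁ ⥲ Im f`).
[cite: CattaniElZeinGriffithsLe2014, Thm. 3.2.18] -/
theorem hodgeNumber_range_eq_of_injective [FiniteDimensional ℚ V] [FiniteDimensional ℚ V']
    (f : MixedHodgeStructure.Hom H₁ H₂) (hf : Function.Injective f.toLinearMap) (p q : ℤ) :
    f.range.toMixedHodgeStructure.hodgeNumber p q = H₁.hodgeNumber p q :=
  (f.rangeRestrict.hodgeNumber_eq_of_bijective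
    ⟨fun x y hxy => hf (by simpa only [coe_rangeRestrict_apply] using congrArg Subtype.val hxy),
      f.rangeRestrict_surjective⟩ p q).symm

/-- **`h^{p,q}(Im g) = h^{p,q}(H₃)` for a surjective morphism** (`Im g = H₃`).
[cite: CattaniElZeinGriffithsLe2014, Thm. 3.2.18] -/
theorem hodgeNumber_range_eq_of_surjective [FiniteDimensional ℚ V'] [FiniteDimensional ℚ V'']
    (g : MixedHodgeStructure.Hom H₂ H₃) (hg : Function.Surjective g.toLinearMap) (p q : ℤ) :
    g.range.toMixedHodgeStructure.hodgeNumber p q = H₃.hodgeNumber p q :=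
  g.range.subtype.hodgeNumber_eq_of_bijective
    ⟨g.range.toSubmodule.injective_subtype, fun y => by
      obtain ⟨x, rfl⟩ := hg y
      exact ⟨⟨g.toLinearMap x, LinearMap.mem_range_self _ x⟩, rfl⟩⟩ p q

/-- **`h^{p,q}(H₂) ≤ h^{p,q}(H₁) + h^{p,q}(H₃)` along an exact sequence `H₁ → H₂ → H₃`** (the numerical
form of the exactness of `Gr_F Gr^W`; in particular `h^{p,q}(H₂) = 0` if `h^{p,q}(H₁) = h^{p,q}(H₃) = 0`).
[cite: CattaniElZeinGriffithsLe2014, Cor. 3.2.21 (ii)] -/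
theorem hodgeNumber_le_of_exact [FiniteDimensional ℚ V] [FiniteDimensional ℚ V'] [FiniteDimensional ℚ V'']
    {f : MixedHodgeStructure.Hom H₁ H₂} {g : MixedHodgeStructure.Hom H₂ H₃}
    (hfg : Function.Exact f.toLinearMap g.toLinearMap) (p q : ℤ) :
    H₂.hodgeNumber p q ≤ H₁.hodgeNumber p q + H₃.hodgeNumber p q := by
  rw [hodgeNumber_eq_of_exact hfg, f.hodgeNumber_source_eq p q, ← f.hodgeNumber_coimage_eq p q]
  have h3 := g.range.hodgeNumber_le p q
  have : f.coimage.hodgeNumber p q ≤ f.ker.toMixedHodgeStructure.hodgeNumber p q + f.coimage.hodgeNumber p q :=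
    Nat.le_add_left _ _
  omega

/-- `h^{p,q}(H₂) = 0` along an exact `H₁ → H₂ → H₃` with `h^{p,q}(H₁) = h^{p,q}(H₃) = 0` (cf. the tree's
`deligneI_eq_bot_of_exact`). [cite: CattaniElZeinGriffithsLe2014, Cor. 3.2.21 (ii)] -/
theorem hodgeNumber_eq_zero_of_exact [FiniteDimensional ℚ V] [FiniteDimensional ℚ V']
    [FiniteDimensional ℚ V''] {f : MixedHodgeStructure.Hom H₁ H₂} {g : MixedHodgeStructure.Hom H₂ H₃}
    (hfg : Function.Exact f.toLinearMap g.toLinearMap) {p q : ℤ} (h₁ : H₁.hodgeNumber p q = 0)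
    (h₃ : H₃.hodgeNumber p q = 0) : H₂.hodgeNumber p q = 0 := by
  have h := hodgeNumber_le_of_exact hfg p q
  rw [h₁, h₃, add_zero] at h
  exact Nat.le_zero.1 h

/-- **Additivity of Hodge numbers on short exact sequences `0 → H₁ → H₂ → H₃ → 0` of MHS:
`h^{p,q}(H₂) = h^{p,q}(H₁) + h^{p,q}(H₃)`** (Cor. 3.2.21 (ii): `Gr_F Gr^W` is exact).
[cite: CattaniElZeinGriffithsLe2014, Cor. 3.2.21 (ii)] -/
theorem hodgeNumber_eq_add_of_shortExact [FiniteDimensional ℚ V] [FiniteDimensional ℚ V']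
    [FiniteDimensional ℚ V''] {f : MixedHodgeStructure.Hom H₁ H₂} {g : MixedHodgeStructure.Hom H₂ H₃}
    (hf : Function.Injective f.toLinearMap) (hfg : Function.Exact f.toLinearMap g.toLinearMap)
    (hg : Function.Surjective g.toLinearMap) (p q : ℤ) :
    H₂.hodgeNumber p q = H₁.hodgeNumber p q + H₃.hodgeNumber p q := by
  rw [hodgeNumber_eq_of_exact hfg, f.hodgeNumber_range_eq_of_injective hf,
    g.hodgeNumber_range_eq_of_surjective hg]

/-- In a short exact sequence `0 → H₁ → H₂ → H₃ → 0`, `h^{p,q}(H₁) ≤ h^{p,q}(H₂)` and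
`h^{p,q}(H₃) ≤ h^{p,q}(H₂)`. [cite: CattaniElZeinGriffithsLe2014, Cor. 3.2.21 (ii)] -/
theorem hodgeNumber_le_of_shortExact [FiniteDimensional ℚ V] [FiniteDimensional ℚ V']
    [FiniteDimensional ℚ V''] {f : MixedHodgeStructure.Hom H₁ H₂} {g : MixedHodgeStructure.Hom H₂ H₃}
    (hf : Function.Injective f.toLinearMap) (hfg : Function.Exact f.toLinearMap g.toLinearMap)
    (hg : Function.Surjective g.toLinearMap) (p q : ℤ) :
    H₁.hodgeNumber p q ≤ H₂.hodgeNumber p q ∧ H₃.hodgeNumber p q ≤ H₂.hodgeNumber p q := by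
  rw [hodgeNumber_eq_add_of_shortExact hf hfg hg]
  exact ⟨Nat.le_add_right _ _, Nat.le_add_left _ _⟩

end Hom

end MixedHodgeStructure

end Literature.AlgebraicGeometry.Motives

end
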